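import Summits.AtomisticToContinuum.HydrodynamicLimit.Theorems.AntiMazurCoboundariesCellForecastPressureDecayObjects
import Literature.MathematicalPhysics.StatisticalMechanics.SpecificRelativeEntropy
import Literature.MathematicalPhysics.StatisticalMechanics.HardSphereGibbs
import Literature.Analysis.FluidPDE.InfiniteHardSphereDynamics
import Literature.Analysis.FunctionSpaces.PointConfigFactorialMeasure
import HarnessLib

/-!
# Objects of the crux line `entropy-ball-invariant-states`
# (crux `CellForecastPressureDecay`, stmt-AtomisticToContinuum-13915; route AntiMazurCoboundaries)

Objects module of the registered skeleton `Cruxes/CellForecastPressureDecay/Lines/entropy-ball-invariant-states.lean`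
(crux-plan g2 skeleton `98b41a1f1bfe` as reshaped by the lead `prover-line-stmt-AtomisticToContinuum-13915-1`),
moved VERBATIM into an importable `Theorems` module so that the stub helper files of the line (`--supports
stmt-AtomisticToContinuum-13915`) and the closing file share ONE copy (pattern: the two sibling `…Objects.lean`):

* § 1 the finite-volume frames: `TorusFlow`, `TorusClusterFlows`, `TorusPhase`, the cell functional
  `cellWindowPressure` of the crux (verbatim its left-hand side, over the cell law `TiltAnalyticity.cellLaw` of
  the sibling objects module), the torus canonical Gibbs law `torusGibbs`, the torus score `fluxSum` and the
  torus exponential moment `torusExpMoment`, with the bookkeeping `abs_fluxSum_le`, `measurable_fluxSum`,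
  `cellWindowPressure_eq`;
* § 2 the registered finite-volume stub STATEMENTS: `TorusGibbsInvariance` (the torus canonical law is invariant
  under every torus hard-sphere flow — Liouville + energy conservation; provable now), `EntropyBallDuality` (exact
  Donsker–Varadhan duality with a Krylov–Bogoliubov witness; provable now), `TorusInfluenceLocality` (finite speed
  of influence in exponential moments, range after horizon), `CellToTorusReduction` (free-boundary cell with
  Euclidean forecasts → periodic true dynamics), `KrylovBogoliubovClosure` (almost-invariant entropy-ball states
  are stiff up to `η` per volume) — the last three TRUE-grade, sizes L–XL;
* § 3 the infinite-volume objects: the ONE-BODY BIAS `oneBodyBias g ν` (Campbell integral against the first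
  factorial moment measure), the dynamics-free invariance notion of the line — range-`R` FORECAST FUNCTIONAL
  `forecastFunctional` (every `k`-body local observable evaluated on the isolated-cluster forecasts of the tree,
  `localClusterState`, enumerations averaged through `PointConfig.factorialMeasure`), STATIC functional
  `staticFunctional`, CAPPED FORECAST-STATIONARITY `IsForecastStationary σ ν` — the entropy currency
  (`idealGasIntensity ρ = ρ·Leb ⊗ N(0,I₃)`, whose Poisson field exists: `exists_isPoissonPointProcess_idealGasIntensity`;
  `hsExcessFreeEnergyDensity σ ρ = ρ·F(ρσ³)`, `F = hsExcessFreeEnergy`, a true limit by the PROVED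
  `ImplosionDichotomy.HsEosLowDensity`), and the registered OPEN stub statement `OneBodyEntropicStiffness` (the
  card's C⁺: invariant near-Gibbs states of the infinite dilute gas have one-body bias bounded LINEARLY by their
  free-energy deficit in the fast directions);
* § 4 the registered bookkeeping stub `stub_objects` (read-back of the cell functional, non-vacuity of the Poisson
  reference, the pointwise bound on the torus score).

Why capped and dynamics-free (skeleton § 0.2, triage r1-1 (v) / r1-3 (b)): temperedness is not an entropy-ball
property, so no infinite-volume flow is quantified; forecasts of different particles come from different isolated
cluster dynamics and need not be jointly hard-core, so uncapped `k`-tuple sums can be spoiled by one bad particle —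
with the cap the transfer bound is linear in the density of bad particles. Units: cell frame = the crux's (cube
`[0,L]³`, `n ≤ 2L³` spheres of diameter `σ`, horizon `T`, range `R`); torus frame = unit torus, same `n` spheres of
diameter `σ/Λ`, lengths and times `/Λ`, velocities not rescaled. Nothing is proved here beyond bookkeeping; see the
line card `Cruxes/CellForecastPressureDecay/Lines/entropy-ball-invariant-states.md`.
-/

noncomputable section

open MeasureTheory ProbabilityTheory Set Filter Topology
open scoped ENNReal Classical

namespace Summit.AtomisticToContinuum.HydrodynamicLimit.Theorems.EntropyBall

open Literature.MathematicalPhysics.KineticTheory (T3 V3 hsExcessFreeEnergy)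
open Literature.Analysis.FunctionSpaces (PointConfig IsPoissonPointProcess)
open Literature.Analysis.FluidPDE (HardSphereFlow Config localClusterState canonicalDensity particleLaw
  globalMaxwellian IsTranslationInvariant IsHardCore kineticEnergyDensity)
open Literature.MathematicalPhysics.StatisticalMechanics (specificRelativeEntropy HasFiniteSpecificEntropy
  unitCube intensity)
open Summit.AtomisticToContinuum.HydrodynamicLimit.Theorems.TiltAnalyticity (Flows cellLaw)

/-! ## § 1 Finite-volume frames -/

/-- Hard-sphere flows of `n` spheres of diameter `ε` on the unit torus `𝕋³`. -/
abbrev TorusFlow (ε : ℝ) (n : ℕ) : Type :=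
  HardSphereFlow (Literature.Analysis.FluidPDE.Torus.geometry (Fin 3)) ε n

/-- Families of isolated torus cluster flows of diameter `ε` (forecasts on the torus). -/
abbrev TorusClusterFlows (ε : ℝ) : Type :=
  (k : ℕ) → HardSphereFlow (Literature.Analysis.FluidPDE.Torus.geometry (Fin 3)) ε k

/-- Phase space of `n` labelled spheres on `𝕋³`. -/
abbrev TorusPhase (n : ℕ) : Type := Config n (Fin 3) T3

/-- The crux's cell functional: `∫⁻ exp(2c Σ_{i<n} T⁻¹∫₀ᵀ g(v^{fc}_i(t)) dt) dP_{n,L}` — verbatim the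
left-hand side of `AntiMazurCoboundaries.CellForecastPressureDecay`, over the canonical cell Gibbs law
`TiltAnalyticity.cellLaw σ n L (Ψ n)` (which is the crux's measure verbatim). -/
def cellWindowPressure (σ : ℝ) (g : V3 → ℝ) (c T R L : ℝ) (n : ℕ) (Ψ : Flows σ) : ℝ≥0∞ :=
  ∫⁻ z, ENNReal.ofReal (Real.exp (2 * c * ∑ i : Fin n, T⁻¹ * ∫ t in (0 : ℝ)..T,
      g (localClusterState Ψ R t z i).2)) ∂(cellLaw σ n L (Ψ n))

/-- Read-back: the cell functional is the crux's integral against the crux's measure, on the nose. -/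
theorem cellWindowPressure_eq (σ : ℝ) (g : V3 → ℝ) (c T R L : ℝ) (n : ℕ) (Ψ : Flows σ) :
    cellWindowPressure σ g c T R L n Ψ =
      ∫⁻ z, ENNReal.ofReal (Real.exp (2 * c * ∑ i : Fin n, T⁻¹ * ∫ t in (0 : ℝ)..T,
        g (localClusterState Ψ R t z i).2))
        ∂(particleLaw (Ψ n) (canonicalDensity (Literature.Analysis.FluidPDE.Euclidean.geometry (Fin 3)) σ n
          (fun p => Set.indicator {x : V3 | ∀ k, x k ∈ Set.Icc (0 : ℝ) L} (fun _ => (1 : ℝ)) p.1 *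
            globalMaxwellian p.2))) := rfl

/-- The torus canonical Gibbs law: `n` spheres of diameter `ε` on `𝕋³`, positions uniform on the
hard-core configurations, standard Maxwellian velocities. It is the i.i.d. law `π = (unif ⊗ M)^{⊗n}`
CONDITIONED on the hard core, `dG/dπ = 𝟙_{hc}/Z'` with `Z' = π(hard core)`; a probability measure as soon
as the canonical partition function is positive, the zero measure otherwise (junk of
`canonicalDensity`). Invariant under every torus hard-sphere flow (`TorusGibbsInvariance`). -/
def torusGibbs (ε : ℝ) (n : ℕ) (Φ : TorusFlow ε n) : Measure (TorusPhase n) :=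
  particleLaw Φ (canonicalDensity (Literature.Analysis.FluidPDE.Torus.geometry (Fin 3)) ε n
    (fun p => globalMaxwellian p.2))

/-- The torus twin of the crux's score along the TRUE dynamics: `f(z) = 2c' Σ_i g(v_i)`. -/
def fluxSum (g : V3 → ℝ) (c' : ℝ) (n : ℕ) (z : TorusPhase n) : ℝ :=
  2 * c' * ∑ i : Fin n, g ((z i).2)

/-- Exponential moment, under the torus Gibbs law, of the window-`τ` time average of `f` along the
torus flow: `∫⁻ exp(τ⁻¹ ∫₀^τ f(Φ_t z) dt) dG` (torus time units). -/
def torusExpMoment (ε : ℝ) (n : ℕ) (Φ : TorusFlow ε n) (f : TorusPhase n → ℝ) (τ : ℝ) : ℝ≥0∞ :=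
  ∫⁻ z, ENNReal.ofReal (Real.exp (τ⁻¹ * ∫ t in (0 : ℝ)..τ, f (Φ.flow t z))) ∂(torusGibbs ε n Φ)

/-- `|fluxSum g c' n z| ≤ 2 |c'| n κ` when `|g| ≤ κ`. -/
theorem abs_fluxSum_le {g : V3 → ℝ} {κ : ℝ} (hgκ : ∀ v, |g v| ≤ κ) (c' : ℝ) (n : ℕ)
    (z : TorusPhase n) : |fluxSum g c' n z| ≤ 2 * |c'| * (n * κ) := by
  have hsum : |∑ i : Fin n, g ((z i).2)| ≤ n * κ := by
    calc |∑ i : Fin n, g ((z i).2)| ≤ ∑ i : Fin n, |g ((z i).2)| := Finset.abs_sum_le_sum_abs _ _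
      _ ≤ ∑ _i : Fin n, κ := Finset.sum_le_sum fun i _ => hgκ _
      _ = n * κ := by simp
  unfold fluxSum
  rw [abs_mul, abs_mul, abs_two]
  exact mul_le_mul_of_nonneg_left hsum (by positivity)

/-- `fluxSum` is measurable for continuous `g` (the torus phase space is a Borel space). -/
theorem measurable_fluxSum {g : V3 → ℝ} (hg : Continuous g) (c' : ℝ) (n : ℕ) :
    Measurable (fluxSum g c' n) := by
  unfold fluxSum
  refine Measurable.const_mul ?_ _
  refine Finset.measurable_sum _ fun i _ => ?_
  exact hg.measurable.comp ((measurable_pi_apply i).snd)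

/-! ## § 2 The registered finite-volume stub statements -/

/-- Statement of `stub_torusGibbsInvariant` — **THE TORUS CANONICAL LAW IS FLOW-INVARIANT (TRUE,
provable now; size S).** For every diameter `ε`, particle number `n`, torus hard-sphere flow `Φ` and time
`t`, the push-forward of `torusGibbs ε n Φ` under `Φ.flow t` is `torusGibbs ε n Φ` itself: Liouville's
theorem (`HardSphereFlow.measurePreserving`) plus invariance of the density `𝒵⁻¹ 𝟙_{D_ε} ∏ M(v_i)` on the
conull good set (kinetic-energy conservation `HardSphereFlow.configEnergy_flow`, `good ⊆ D_ε` mapped to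
itself). Pattern: `Theorems.BoltzmannGreenKuboOrthMomentum.map_flow_localGibbsLaw_const` (constant-profile
local Gibbs law, `N + 1` spheres of diameter `hsDiameter σ N`); here the diameter and the particle number
are free. No positivity hypothesis is needed (if `𝒵 = 0` both sides are `0`). -/
def TorusGibbsInvariance : Prop :=
  ∀ (ε : ℝ) (n : ℕ) (Φ : TorusFlow ε n) (t : ℝ), (torusGibbs ε n Φ).map (Φ.flow t) = torusGibbs ε n Φ

/-- Statement of `stub_entropyBallDuality` — **EXACT ENTROPY-BALL DUALITY WITH A KRYLOV–BOGOLIUBOV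
WITNESS (finite volume; TRUE, provable now; the card's two levers in one line each).** On the torus,
whenever the canonical law `G = torusGibbs` is a probability measure, for every bounded measurable
`f` and window `τ > 0` there is a probability law `μ ≪ G` with `KL(μ | G) ≤ 2‖f‖∞`, which is
`(2s/τ)`-ALMOST INVARIANT (`|μ(Φ_s⁻¹B) − μ(B)| ≤ 2s/τ`), such that
`∫⁻ e^{τ⁻¹∫₀^τ f∘Φ_t} dG ≤ exp(E_μ f − KL(μ | G))`.
Proof: `λ := e^{A}G/Z`, `A = τ⁻¹∫₀^τ f∘Φ_t` (`|A| ≤ ‖f‖∞` everywhere, junk included; a.e.-measurable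
on the conull good set, `HardSphereFlow.aemeasurable_intervalIntegral_comp_flow_torus`);
Donsker–Varadhan / Gibbs: `log Z = E_λ A − KL(λ|G)`, so `KL(λ|G) ≤ 2‖f‖∞`; `μ := τ⁻¹∫₀^τ λΦ_t⁻¹ dt`
(K–B average; as a measure with density `τ⁻¹∫₀^τ (dλ/dG)∘Φ_{−t} dt` w.r.t. the INVARIANT `G`):
`E_μ f = E_λ A` (Fubini — LINEARITY, lossless), `KL(μ|G) ≤ τ⁻¹∫ KL(λΦ_t⁻¹|G) = KL(λ|G)` (pointwise
Jensen for `x log x` on the time average + Fubini + invariance of `G`, `TorusGibbsInvariance`), and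
`μΦ_s⁻¹ − μ = τ⁻¹(∫_τ^{τ+s} − ∫_0^s) λΦ_t⁻¹ dt` (group law on the good set, `λ ≪ G`), of total
variation `≤ 2s/τ`. -/
def EntropyBallDuality : Prop :=
  ∀ (ε : ℝ) (n : ℕ) (Φ : TorusFlow ε n), 0 < ε →
    IsProbabilityMeasure (torusGibbs ε n Φ) →
    ∀ f : TorusPhase n → ℝ, Measurable f → ∀ C : ℝ, (∀ z, |f z| ≤ C) → ∀ τ : ℝ, 0 < τ →
      ∃ μ : Measure (TorusPhase n), IsProbabilityMeasure μ ∧ μ ≪ torusGibbs ε n Φ ∧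
        InformationTheory.klDiv μ (torusGibbs ε n Φ) ≤ ENNReal.ofReal (2 * C) ∧
        (∀ s : ℝ, 0 ≤ s → ∀ B : Set (TorusPhase n), MeasurableSet B →
          |(μ (Φ.flow s ⁻¹' B)).toReal - (μ B).toReal| ≤ 2 * s / τ) ∧
        torusExpMoment ε n Φ f τ ≤
          ENNReal.ofReal (Real.exp (∫ z, f z ∂μ - (InformationTheory.klDiv μ (torusGibbs ε n Φ)).toReal))

/-- Statement of `stub_influenceLocality` — **FINITE SPEED OF INFLUENCE IN EXPONENTIAL MOMENTS ON THE
TORUS, at the horizon chosen BEFORE the range** (sibling of route crux `InfluenceLocality`,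
stmt-13916, read in the cell scaling and UNIFORMLY over densities `n/Λ³ ≤ 2`, for EVERY `R ≥ R₀`;
triage r1-1/2/3 certified that this quantifier order survives the sprinter / relay / avalanche counts
that kill linear cones, the LD cone `R₀(s, lam)` being super-linear but finite). On `𝕋³` with
`n ≤ 2Λ³` spheres of diameter `σ/Λ` under the canonical law `torusGibbs`: for every horizon `s` (cell
units; `s/Λ` torus), tilt `lam` and `δ > 0` there is `R₀` such that for `R ≥ R₀` and all large `Λ`,
uniformly in `n`, the torus flow and the torus cluster flows,
`∫⁻ exp(lam · #{i : ∃ t ≤ s/Λ, Φ_t z i ≠ its (R/Λ)-local torus forecast}) dG ≤ e^{δΛ³}`.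
Consumed twice on the line: forecast → true dynamics in `stub_torusReduction`, forecast-stationarity
of local limits in `stub_kbClosure`. -/
def TorusInfluenceLocality : Prop :=
  ∃ σ₀ : ℝ, 0 < σ₀ ∧ ∀ σ : ℝ, 0 < σ → σ < σ₀ →
    ∀ (s lam δ : ℝ), 0 < s → 0 < lam → 0 < δ → ∃ R₀ : ℝ, 0 < R₀ ∧ ∀ R : ℝ, R₀ ≤ R →
      ∃ Λ₀ : ℝ, 0 < Λ₀ ∧ ∀ Λ : ℝ, Λ₀ ≤ Λ → ∀ n : ℕ, (n : ℝ) ≤ 2 * Λ ^ 3 →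
        ∀ (Φ : TorusFlow (σ / Λ) n) (Ψ : TorusClusterFlows (σ / Λ)),
          ∫⁻ z, ENNReal.ofReal (Real.exp (lam *
              ((Finset.univ.filter fun i : Fin n =>
                ∃ t ∈ Set.Icc (0 : ℝ) (s / Λ), Φ.flow t z i ≠ localClusterState Ψ (R / Λ) t z i).card : ℝ)))
            ∂(torusGibbs (σ / Λ) n Φ) ≤ ENNReal.ofReal (Real.exp (δ * Λ ^ 3))

/-- Statement of `stub_torusReduction`'s conclusion — **CELL → TORUS REDUCTION, UNIFORM IN THE
PARTICLE NUMBER AND THE TILT (free b.c. forecasts → periodic true dynamics on a torus of comparable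
size, one Hölder tilt inflation).** For fixed `(σ, κ, g, T)` and every `η, ε > 0` there is a range `R₀`
such that for `R ≥ R₀` and all large `L`, for EVERY `n ≤ 2L³`, every family of Euclidean cluster flows
and every `|c| ≤ 1`, the cell functional is bounded by `e^{ηL³}` times (`1 ⊔`) the torus exponential
moment of the window-`T/Λ` time average of `2c' Σ_i g(v_i)` along SOME flow of the SAME `n` spheres
on a torus of side `Λ ∈ [L, 2L]` (cell units; diameter `σ/Λ` on the unit torus; all flows agree a.e.),
for SOME `|c'| ≤ (1+ε)|c|`, the torus Gibbs law being a probability measure.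
Proof plan: (i) EMBEDDING — put the cube `[0,L]³` inside the torus of side `Λ = L + σ`: for centres
in the cube the torus and the Euclidean hard-core constraints coincide, so the cell law IS the torus
canonical law conditioned on `A = {all particles in the cube}`, and `G(A) ≥ e^{−6σL² − o(L³)}`
uniformly in `n ≤ 2L³` (free-volume ratio at two nearby reduced densities, via the PROVED equation of
state `Theorems.hsEosLowDensity_proof` and monotonicity); on `A` the Euclidean and torus `R`-local
scores differ only for the `O(L²R/σ³)` particles within `R` of the faces and for clusters containing a
particle of speed `≳ L/(T√m_R)` — total `e^{O(κL²R/σ³) + o(L³)}`; (ii) forecast → true dynamics on the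
torus by Hölder `(1+ε, (1+ε)/ε)` and `TorusInfluenceLocality` with `s = T`, `lam = 4κ(1+ε)/ε`,
`δ = η/8`; (iii) `I^{1/(1+ε)} ≤ 1 ⊔ I`; `torusGibbs` is a probability measure by an explicit lattice
packing (`n(σ/Λ)³ ≤ 2σ³`). No orthogonality of `g` is used. -/
def CellToTorusReduction : Prop :=
  ∃ σ₀ : ℝ, 0 < σ₀ ∧ ∀ σ : ℝ, 0 < σ → σ < σ₀ → ∀ κ : ℝ, 0 < κ →
    ∀ g : V3 → ℝ, Continuous g → (∀ v, |g v| ≤ κ) →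
    ∀ T : ℝ, 0 < T → ∀ η : ℝ, 0 < η → ∀ ε : ℝ, 0 < ε →
      ∃ R₀ : ℝ, 0 < R₀ ∧ ∀ R : ℝ, R₀ ≤ R → ∃ L₀ : ℝ, 0 < L₀ ∧ ∀ L : ℝ, L₀ ≤ L →
        ∀ n : ℕ, (n : ℝ) ≤ 2 * L ^ 3 → ∀ Ψ : Flows σ, ∀ c : ℝ, |c| ≤ 1 →
          ∃ Λ : ℝ, L ≤ Λ ∧ Λ ≤ 2 * L ∧
            ∃ (Φ : TorusFlow (σ / Λ) n) (c' : ℝ),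
              IsProbabilityMeasure (torusGibbs (σ / Λ) n Φ) ∧ |c'| ≤ (1 + ε) * |c| ∧
              cellWindowPressure σ g c T R L n Ψ ≤
                ENNReal.ofReal (Real.exp (η * L ^ 3)) *
                  (1 ⊔ torusExpMoment (σ / Λ) n Φ (fluxSum g c' n) (T / Λ))

/-- Statement of `stub_kbClosure`'s conclusion — **KRYLOV–BOGOLIUBOV CLOSURE: almost-invariant torus
states in the entropy ball are stiff, up to `η` per volume, once the window is long (TRUE-grade GIVEN
one-body entropic stiffness and influence locality; size L).** For `σ < σ₀`, an amplitude `κ`,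
admissible `g`, entropy budget `C₀` and `η > 0` there is `T₀` such that for `T ≥ T₀` and all large `Λ`,
for every particle number `n ≤ 2Λ³` (diameter `σ/Λ` on the unit torus): every probability law `μ ≪ G`
with `KL(μ|G) ≤ C₀Λ³` and `|μ(Φ_s⁻¹B) − μ(B)| ≤ 2sΛ/T` (all torus times `s ≥ 0`, i.e. defect
`2 s_cell/T`) satisfies `E_μ[2c' Σ_i g(v_i)] ≤ |c'| KL(μ|G) + ηΛ³` for every `|c'| ≤ 2`.
Proof plan (by contradiction along `T_k → ∞`, `Λ_k → ∞`, `n_k/Λ_k³ → ρ*`, `c'_k → c*`; local limits of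
blown-up torus states; Poisson superadditivity + lower semicontinuity of relative entropy; the PROVED
hard-sphere equation of state for `log Z'`; capped forecast-stationarity of the K–B limits by the
global entropy inequality with `TorusInfluenceLocality`; `OneBodyEntropicStiffness` at the limit) on the
line card. Cheap checks: `μ = G` needs `2c'nE_M g ≤ ηΛ³`, TRUE by `g ⊥ 1`; thermal tilts and
energy-shell conditionings of `G` are exactly invariant and stiff iff `κ < κ*` (`∃κ`); product velocity
tilts are NOT almost invariant in the global total-variation sense and do not enter. -/
def KrylovBogoliubovClosure : Prop :=
  ∃ σ₀ : ℝ, 0 < σ₀ ∧ ∀ σ : ℝ, 0 < σ → σ < σ₀ → ∃ κ : ℝ, 0 < κ ∧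
    ∀ g : V3 → ℝ, Continuous g → (∀ v, |g v| ≤ κ) →
      (∀ (c₀ c₂ : ℝ) (b : V3),
        ∫ v, g v * (c₀ + inner ℝ b v + c₂ * ‖v‖ ^ 2) ∂(ProbabilityTheory.stdGaussian V3) = 0) →
      ∀ C₀ : ℝ, 0 < C₀ → ∀ η : ℝ, 0 < η →
        ∃ T₀ : ℝ, 0 < T₀ ∧ ∀ T : ℝ, T₀ ≤ T → ∃ Λ₀ : ℝ, 0 < Λ₀ ∧ ∀ Λ : ℝ, Λ₀ ≤ Λ →
          ∀ n : ℕ, (n : ℝ) ≤ 2 * Λ ^ 3 →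
          ∀ (Φ : TorusFlow (σ / Λ) n) (μ : Measure (TorusPhase n)),
            IsProbabilityMeasure (torusGibbs (σ / Λ) n Φ) → IsProbabilityMeasure μ →
            μ ≪ torusGibbs (σ / Λ) n Φ →
            InformationTheory.klDiv μ (torusGibbs (σ / Λ) n Φ) ≤ ENNReal.ofReal (C₀ * Λ ^ 3) →
            (∀ s : ℝ, 0 ≤ s → ∀ B : Set (TorusPhase n), MeasurableSet B →
              |(μ (Φ.flow s ⁻¹' B)).toReal - (μ B).toReal| ≤ 2 * s * Λ / T) →
            ∀ c' : ℝ, |c'| ≤ 2 →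
              ∫ z, fluxSum g c' n z ∂μ ≤
                |c'| * (InformationTheory.klDiv μ (torusGibbs (σ / Λ) n Φ)).toReal + η * Λ ^ 3

/-! ## § 3 Infinite-volume objects and the open stub statement -/

/-- ONE-BODY BIAS of a law `ν` on marked configurations of `ℝ³ × ℝ³` in the fast direction `g`:
`E_ν[Σ_{(q,v) ∈ ω, q ∈ [0,1)³} g(v)] = ρ_ν ⟨g, f₁^ν⟩` — written junk-free as the integral of
`1_{[0,1)³}(q) g(v)` against the first factorial moment (intensity) measure of `ν`
(`PointConfig.corrMeasure ν 1`, Campbell's formula; finite intensity makes the integrand integrable). -/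
def oneBodyBias (g : V3 → ℝ) (ν : Measure (PointConfig (V3 × V3))) : ℝ :=
  ∫ p, (unitCube : Set V3).indicator (fun _ => (1 : ℝ)) (p 0).1 * g (p 0).2 ∂(PointConfig.corrMeasure ν 1)

/-- The phase-space window above the closed ball of radius `r` about the origin. -/
def ballWindow (r : ℝ) : Set (V3 × V3) := Metric.closedBall (0 : V3) r ×ˢ Set.univ

/-- `k`-BODY FORECAST FUNCTIONAL (dynamics-free: only FINITE isolated cluster flows `Ψ k` enter).
Enumerate the particles of `ω` with position in `B̄(0, r + 2R)` (averaging over the `m!` enumerations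
`z`, i.e. integrating against `PointConfig.factorialMeasure` and dividing by `m!`), let every particle
with initial position in `B̄(0, r + R)` be FORECAST by the isolated Euclidean dynamics of its range-`R`
cluster (tree `localClusterState`; that cluster lies inside the enumerated window), and sum the test
function `φ` over ordered `k`-tuples of distinct such particles evaluated at their forecast states at
time `s`. Junk-free: if the window holds infinitely many particles every summand is `0`. Test functions
`φ ≤ 1` are meant to vanish unless all `k` positions lie in `B̄(0,r)` (imposed where used), so that in
the limit `R → ∞` nothing is missed but "jumpers". The forecasts of DIFFERENT particles come from
DIFFERENT isolated dynamics, so the forecast positions are not jointly hard-core and this sum is not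
packing-bounded — whence the cap in `IsForecastStationary`. -/
def forecastFunctional {σ : ℝ} (Ψ : Flows σ) (r R s : ℝ) (k : ℕ)
    (φ : (Fin k → V3 × V3) → ℝ≥0∞) (ω : PointConfig (V3 × V3)) : ℝ≥0∞ :=
  ∑' m : ℕ, if ω.count (ballWindow (r + 2 * R)) = (m : ℕ∞) then
    ((Nat.factorial m : ℝ≥0∞))⁻¹ *
      ∫⁻ z, (∑ j : Fin k ↪ Fin m,
          (∏ a : Fin k, (Metric.closedBall (0 : V3) (r + R)).indicator (fun _ => (1 : ℝ≥0∞)) (z (j a)).1) *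
            φ (fun a => localClusterState Ψ R s z (j a)))
        ∂(PointConfig.factorialMeasure m (ω.restrict (ballWindow (r + 2 * R))))
    else 0

/-- The STATIC `k`-body window functional `Σ^{≠}_{p₁,…,p_k ∈ ω, positions in B̄(0,r)} φ(p₁,…,p_k)`
(integration against the `k`-th factorial measure of the restricted configuration; its `ν`-expectation
is the `k`-th factorial moment measure of `ν` tested against `φ`). On a hard-core configuration it is at
most `P_r^k`, `P_r` the packing number of `B̄(0,r)`. -/
def staticFunctional (r : ℝ) (k : ℕ) (φ : (Fin k → V3 × V3) → ℝ≥0∞) (ω : PointConfig (V3 × V3)) :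
    ℝ≥0∞ :=
  ∫⁻ p, φ p ∂(PointConfig.factorialMeasure k (ω.restrict (ballWindow r)))

/-- CAPPED FORECAST-STATIONARITY of a law `ν` on marked configurations (the dynamics-free invariance
notion of this line): for every family of isolated Euclidean cluster flows, every radius `r`, horizon
`s ≥ 0`, order `k`, CAP `N` and every bounded measurable `k`-body test function supported over
`B̄(0,r)^k`, the expectation of the range-`R` forecast functional truncated at `N` converges, as
`R → ∞`, to the expectation of the static functional truncated at `N` — ALL correlation functions are
stationary under the cluster dynamics in the limit of infinite range, pile-ups of wrong forecasts being
discounted. For a tempered state carried by a LOCAL infinite hard-sphere flow this is EQUIVALENT to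
flow-stationarity (dominated convergence thanks to the cap; caps `N ≥ P_r^k` do not truncate the static
side; factorial moment measures of all orders determine a hard-core marked point field); it needs no
infinite-volume flow, is what Krylov–Bogoliubov provably delivers (`stub_kbClosure`), and its
`k = 1, 2` instances are what the stationary BBGKY balance identities consume. -/
def IsForecastStationary (σ : ℝ) (ν : Measure (PointConfig (V3 × V3))) : Prop :=
  ∀ Ψ : Flows σ, ∀ r s : ℝ, 0 < r → 0 ≤ s → ∀ k N : ℕ,
    ∀ φ : (Fin k → V3 × V3) → ℝ≥0∞, Measurable φ → (∀ p, φ p ≤ 1) →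
      (∀ p, (∃ a, (p a).1 ∉ Metric.closedBall (0 : V3) r) → φ p = 0) →
        Tendsto (fun R : ℕ => ∫⁻ ω, min (forecastFunctional Ψ r R s k φ ω) (N : ℝ≥0∞) ∂ν) atTop
          (𝓝 (∫⁻ ω, min (staticFunctional r k φ ω) (N : ℝ≥0∞) ∂ν))

/-- The one-particle intensity measure of the IDEAL GAS of density `ρ` at `θ = 1`, `u₀ = 0`:
`ρ · Leb(dq) ⊗ N(0, I₃)(dv)` on `ℝ³ × ℝ³` (locally finite, atomless). Its Poisson field `Π_ρ`
(`IsPoissonPointProcess (idealGasIntensity ρ) Π`; existence and uniqueness are PROVED in the tree) is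
the reference of the entropy currency below; unlike the canonical Gibbs law it is a PRODUCT over disjoint
windows (superadditivity of relative entropy). -/
def idealGasIntensity (ρ : ℝ) : Measure (V3 × V3) :=
  ENNReal.ofReal ρ • ((volume : Measure V3).prod (ProbabilityTheory.stdGaussian V3))

/-- The EXCESS FREE ENERGY DENSITY of the hard-sphere gas of diameter `σ` at density `ρ` (`β = 1`):
`ρ · F(ρσ³)`, `F = hsExcessFreeEnergy` the excess free energy per particle at reduced density
`η = ρσ³` (a true limit, real-analytic near `0` with `F(0) = 0`, `F'(0) = 2π/3`, by the PROVED
`ImplosionDichotomy.HsEosLowDensity`, `Theorems.hsEosLowDensity_proof`). It is the value of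
`h(P_ρ | Π_ρ)` for the Gibbs state `P_ρ` of density `ρ` and the minimum of `h(· | Π_ρ)` over
translation-invariant hard-core states of intensity `ρ` (Gibbs variational principle). -/
def hsExcessFreeEnergyDensity (σ ρ : ℝ) : ℝ :=
  ρ * hsExcessFreeEnergy (ρ * σ ^ 3)

/-- NON-VACUITY of the reference hypothesis of `OneBodyEntropicStiffness`: the ideal-gas Poisson field
exists (the intensity is locally finite and atomless; Kingman's existence theorem is PROVED in the tree,
`HardSphere.isPoissonPointProcess_poissonLaw`). -/
theorem exists_isPoissonPointProcess_idealGasIntensity (ρ : ℝ) :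
    ∃ P : Measure (PointConfig (V3 × V3)), IsPoissonPointProcess (idealGasIntensity ρ) P := by
  have h2 : IsFiniteMeasureOnCompacts (idealGasIntensity ρ) :=
    IsFiniteMeasureOnCompacts.smul _ ENNReal.ofReal_ne_top
  have h0 : ∀ x : V3 × V3, idealGasIntensity ρ {x} = 0 := by
    intro x
    have hx : ({x} : Set (V3 × V3)) = {x.1} ×ˢ {x.2} := by
      ext y; simp [Prod.ext_iff]
    simp only [idealGasIntensity, Measure.smul_apply, smul_eq_mul, hx, Measure.prod_prod]
    simp
  exact ⟨_, Literature.MathematicalPhysics.StatisticalMechanics.HardSphere.isPoissonPointProcess_poissonLaw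
    _ h0⟩

/-- Statement of `stub_oneBodyEntropicStiffness` — **ONE-BODY ENTROPIC STIFFNESS (the card's C⁺, the
bet; OPEN, hardest), in free-energy-deficit currency.** For `σ < σ₀` there is an amplitude `κ > 0` such
that for every admissible fast observable `g` (continuous, `|g| ≤ κ`, `g ⊥ span(1, v, |v|²)` in
`L²(stdGaussian)`), every density `0 < ρ ≤ 2`, the ideal-gas Poisson field `Π_ρ`, and every law `ν` that
is a translation-invariant probability on hard-core configurations, of intensity `ρ`, finite
kinetic-energy density, finite specific entropy relative to `Π_ρ` (Liverani–Olla form) and (capped)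
FORECAST-STATIONARY:
`2 |ρ ⟨g, f₁^ν⟩| ≤ 𝓘_σ(ν) := h(ν | Π_ρ) − ρ F(ρσ³)`,
the FREE-ENERGY DEFICIT of `ν` (= `h(ν | P_ρ)` relative to the Gibbs state of density `ρ` by the Gibbs
variational principle; `≥ 0`, `= 0` iff `ν = P_ρ`). In words: invariant states cannot realise the
Pinsker-extremal trade-off (`bias ≍ √deficit`) in the fast one-body directions. Cheap checks:
`ν = P_ρ` gives `2ρ|E_M g| ≤ 0`, i.e. USES `g ⊥ 1` (Disproof §2); the thermal Gibbs state at temperature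
`1 + s` is forecast-stationary with deficit exactly `ρ(3/2)(s − log(1+s))` against the second-order gain
`2ρ|E_{N(0,(1+s)I)} g| ≤ Cκρs²` (`g ⊥ 1, |v|²`): stiff for all `s` iff `κ < κ*` — the refuters' certified
`∃κ` floor (Disproof §7); likewise drifted states (`g ⊥ v`) and, by affinity of specific entropy and of
the bias, their translation-invariant mixtures; states with Maxwellian one-body velocity law have bias
`0`; the `σ = 0` / `d = 1` product states `Poisson(ρ Leb ⊗ f)` ARE cheap and forecast-stationary — the
statement is an interaction effect of `d = 3` hard spheres (Disproof §3–6; `κ` may depend on `σ`). Its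
hard slice is stationary molecular chaos (pre-collisional contact pair correlations of invariant
finite-entropy states). By the card's `CheapStateRefutes` (entropy inequality, reversed) ONE cheap
forecast-stationary state refutes the crux, its sibling 10967 and the route's X at once. -/
def OneBodyEntropicStiffness : Prop :=
  ∃ σ₀ : ℝ, 0 < σ₀ ∧ ∀ σ : ℝ, 0 < σ → σ < σ₀ → ∃ κ : ℝ, 0 < κ ∧
    ∀ g : V3 → ℝ, Continuous g → (∀ v, |g v| ≤ κ) →
      (∀ (c₀ c₂ : ℝ) (b : V3),
        ∫ v, g v * (c₀ + inner ℝ b v + c₂ * ‖v‖ ^ 2) ∂(ProbabilityTheory.stdGaussian V3) = 0) →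
      ∀ ρ : ℝ, 0 < ρ → ρ ≤ 2 →
      ∀ P : Measure (PointConfig (V3 × V3)), IsPoissonPointProcess (idealGasIntensity ρ) P →
        ∀ ν : Measure (PointConfig (V3 × V3)), IsProbabilityMeasure ν → IsTranslationInvariant ν →
          (∀ᵐ ω ∂ν, IsHardCore σ ω) → intensity ν = ENNReal.ofReal ρ →
          kineticEnergyDensity ν < ⊤ → HasFiniteSpecificEntropy ν P → IsForecastStationary σ ν →
            2 * |oneBodyBias g ν| ≤ (specificRelativeEntropy ν P).toReal - hsExcessFreeEnergyDensity σ ρ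

/-! ## § 4 The registered bookkeeping stub -/

/-- **S0 · OBJECTS BOOKKEEPING (registered stub `stub_objects`; closed here).** (i) Read-back: the cell functional
`cellWindowPressure` is the crux's integral against the crux's measure, on the nose; (ii) non-vacuity of the
reference hypothesis of `OneBodyEntropicStiffness`: the ideal-gas Poisson field of every density exists;
(iii) the pointwise bound `|fluxSum g c' n z| ≤ 2|c'|·nκ` for `|g| ≤ κ` used by the composition. -/
theorem stub_objects :
    (∀ (σ : ℝ) (g : V3 → ℝ) (c T R L : ℝ) (n : ℕ) (Ψ : Flows σ),
      cellWindowPressure σ g c T R L n Ψ =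
        ∫⁻ z, ENNReal.ofReal (Real.exp (2 * c * ∑ i : Fin n, T⁻¹ * ∫ t in (0 : ℝ)..T,
          g (localClusterState Ψ R t z i).2))
          ∂(particleLaw (Ψ n) (canonicalDensity (Literature.Analysis.FluidPDE.Euclidean.geometry (Fin 3)) σ n
            (fun p => Set.indicator {x : V3 | ∀ k, x k ∈ Set.Icc (0 : ℝ) L} (fun _ => (1 : ℝ)) p.1 *
              globalMaxwellian p.2)))) ∧
    (∀ ρ : ℝ, ∃ P : Measure (PointConfig (V3 × V3)), IsPoissonPointProcess (idealGasIntensity ρ) P) ∧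
    (∀ (g : V3 → ℝ) (κ : ℝ), (∀ v, |g v| ≤ κ) → ∀ (c' : ℝ) (n : ℕ) (z : TorusPhase n),
      |fluxSum g c' n z| ≤ 2 * |c'| * (n * κ)) :=
  ⟨cellWindowPressure_eq, exists_isPoissonPointProcess_idealGasIntensity, fun _ _ h => abs_fluxSum_le h⟩

end Summit.AtomisticToContinuum.HydrodynamicLimit.Theorems.EntropyBall

end
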